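import Literature.NumberTheory.EllipticCurves.Sprung2017.SharpFlatPAdicLFunctionProofs
import HarnessLib

/-!
# Route `ByReductionTypeAtTwo` (rung K4), crux `SupersingularRankZeroAtTwo` (item stmt-BirchSwinnertonDyer-19097), line
# `odd_blind_package`, slot 5 `stub_CD` = CDC_H, hand h9 = HT-C7locE = (hE), conjunct (C) (the LINE BOUND `2^J ≤ #L^E_J`):
# **THE LINE POLYNOMIALS** — for every even `a` and every even level `n = 2k + 2` an explicit pair `(α, β) ∈ ℤ[T]²` with
# `α u_n + β Φ_{2^n}(1+T) u_{n−1} ∈ 2^{k+2} ℤ[T]` and `α v_n + β Φ_{2^n}(1+T) v_{n−1} ∈ ω_n/(T+2) + 2^{k+2} ℤ[T]`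
# (`u = sharpPoly a 2`, `v = flatPoly a 2`; cell `bsd-2adic`, seat `bsd-2adic-tower-1` GEN 62; pen SUMMON 20260831T085936Z)

HONEST FRAMING: THEOREMS ONLY (no definition, no named fact, no instance, no `sorry`); pure polynomial algebra in `ℤ[T]` on top of the
tree's `Sprung2017.sharpPoly / flatPoly / cyclotomicOmega` and the Casoratian `sharpPoly_succ_mul_flatPoly_sub`; a helper `--supports 19097`;
it proves nothing about any curve; BSD is proved for no curve by any of this. bears_on: K4 (19097).

## The mathematics (why these polynomials)

For Sprung's Coleman characterisation `ω_m ∣ P_{m,c_m}(z) + u_m L♯ + v_m L♭` (Def. 5.9) at `p = 2`, the point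
`x = α(γ)·c_n + β(γ)·c_{n−1}` of the local tower has `ω_n ∣ P_{n,x}(z) + L♯ A + L♭ B` with `A = α u_n + β φ_n u_{n−1}`,
`B = α v_n + β φ_n v_{n−1}` (`φ_m = Φ_{2^m}(1+T)`).  With `ε_m := u_m(−2)` and
`α := −(T φ_n u_{n−1} + 4 ε_{n−1})/(T+2)`, `β := (T u_n + 2 ε_n)/(T+2)` (exact divisions: the numerators vanish at `T = −2`, where
`φ_n(−2) = 2`), one gets `(T+2) A = 2 ε_n φ_n u_{n−1} − 4 ε_{n−1} u_n` and, by the Casoratian `u_n v_{n−1} − v_n u_{n−1} = ∏_{i<n} φ_i`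
and `T ∏_{i≤n} φ_i = ω_n`, `(T+2) B = ω_n + 2 ε_n φ_n v_{n−1} − 4 ε_{n−1} v_n`.  Since `2^{⌊m/2⌋} ∣ ε_m` for even `a`
(`ε_{m+2} = a ε_{m+1} − 2 ε_m`), for `n = 2k+2` both right-hand sides are `≡ 0` resp. `≡ ω_n` modulo `2^{k+2}`; dividing by `T + 2`
(a prime element not dividing `2`) gives `A ∈ 2^{k+2}ℤ[T]` and `B ∈ q_n + 2^{k+2}ℤ[T]` with `(T+2) q_n = ω_n`, `q_n(−1) = −1`.  The consumer
(the line-bound file) reads `z(x)` off `P_{n,x}(z)` at `T = −1`: `A ≡ 0` makes `x` annihilated by `Ker Col♭` modulo `2^{k+2}`, `(T+2)B ≡ 0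
(mod ω_n, 2^{k+2})` makes `(1 + g⁻¹) x ∈ 2^{k+2} E((ℚ_∞)_w)`, and `q_n(−1)` odd makes `x` primitive.

* §1 values of `Φ_{2^m}(1+T)` at `T = −2, −1`; `2^{⌊m/2⌋} ∣ u_m(−2)` (`pow_dvd_eval_sharpPoly_neg_two`).
* §2 `exists_eq_C_mul_of_X_add_two_mul_eq` (division by `T + 2` of a `2^s`-multiple), ★ `exists_linePolys` (the pair `(α, β)` with
  `A = 2^{k+2} A'`, `B = q + 2^{k+2} B'`, `(T+2) q = ω_n`, `q(−1) = −1`, `deg q < 2^n`).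

References: [Sprung2012] F. Sprung, J. Number Theory 132 (2012), Def. 5.9 (p. 1495), Def. 7.9 (p. 1503); [Sprung2017] F. Sprung, ANT 11
(2017), §4 Cor. 4.4 (the recursion `u_n`, `v_n`); [Pollack2003] R. Pollack, Duke Math. J. 118 (2003), Thm. 6.17 (`ω_n`).
-/

set_option autoImplicit false
set_option linter.dupNamespace false

noncomputable section

open Polynomial Finset

namespace Summit.BirchSwinnertonDyer.BirchSwinnertonDyer.Theorems

namespace OddBlindLocal

open Literature.NumberTheory.EllipticCurves Literature.NumberTheory.EllipticCurves.Sprung2017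

/-! ## §1 Values of `Φ_{2^m}(1+T)` and the `2`-divisibility of `u_m(−2)` -/

/-- `Φ_2(1+T) = T + 2`. [cite: Sprung2017, §4 Cor. 4.4 (notation)] -/
theorem cyclotomic_two_pow_one_comp : (cyclotomic (2 ^ 1) ℤ).comp (X + 1) = X + 2 := by
  rw [pow_one, cyclotomic_two, add_comp, X_comp, one_comp]
  ring

/-- `Φ_{2^{m+2}}(1+T) = (1+T)^{2^{m+1}} + 1`. [cite: Sprung2017, §4 Cor. 4.4 (notation)] -/
theorem cyclotomic_two_pow_add_two_comp (m : ℕ) :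
    (cyclotomic (2 ^ (m + 2)) ℤ).comp (X + 1) = (X + 1) ^ 2 ^ (m + 1) + 1 := by
  rw [show m + 2 = (m + 1) + 1 by ring, cyclotomic_prime_pow_eq_geom_sum Nat.prime_two]
  simp [Finset.sum_range_succ, add_comp, pow_comp, X_comp, add_comm]

/-- `Φ_{2^{m+2}}(1+T)` at `T = −2` is `2`. [cite: Sprung2017, §4 Cor. 4.4 (notation)] -/
theorem eval_neg_two_cyclotomic_comp_add_two (m : ℕ) :
    ((cyclotomic (2 ^ (m + 2)) ℤ).comp (X + 1)).eval (-2) = 2 := by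
  rw [cyclotomic_two_pow_add_two_comp, eval_add, eval_pow, eval_add, eval_X, eval_one,
    show (-2 : ℤ) + 1 = -1 by norm_num, Even.neg_one_pow (Nat.even_pow.mpr ⟨even_two, Nat.succ_ne_zero m⟩)]
  norm_num

/-- `Φ_{2^{m+1}}(1+T)` at `T = −1` is `1`. [cite: Sprung2017, §4 Cor. 4.4 (notation)] -/
theorem eval_neg_one_cyclotomic_comp_succ (m : ℕ) :
    ((cyclotomic (2 ^ (m + 1)) ℤ).comp (X + 1)).eval (-1) = 1 := by
  rw [eval_comp, eval_add, eval_X, eval_one, show (-1 : ℤ) + 1 = 0 by norm_num, ← coeff_zero_eq_eval_zero,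
    cyclotomic_coeff_zero ℤ (Nat.one_lt_two_pow_iff.mpr (Nat.succ_ne_zero m))]

/-- The recursion of `ε_m = u_m(−2)` from index `1` on: `ε_{m+3} = a ε_{m+2} − 2 ε_{m+1}`.
[cite: Sprung2017, §4 Cor. 4.4] -/
theorem eval_neg_two_sharpPoly_add_three (a : ℤ) (m : ℕ) :
    (sharpPoly a 2 (m + 3)).eval (-2) = a * (sharpPoly a 2 (m + 2)).eval (-2) - 2 * (sharpPoly a 2 (m + 1)).eval (-2) := by
  rw [show m + 3 = (m + 1) + 2 by ring, sharpPoly_add_two, eval_sub, eval_mul, eval_mul, eval_C,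
    show m + 1 + 1 = m + 2 by ring, eval_neg_two_cyclotomic_comp_add_two]

/-- **`2^{⌊m/2⌋} ∣ ε_m = u_m(−2)`** for even `a` (`ε_0 = 0`, `ε_1 = 1`, `ε_2 = a`, `ε_{m+3} = a ε_{m+2} − 2ε_{m+1}`).
[cite: Sprung2017, §4 Cor. 4.4] -/
theorem pow_dvd_eval_sharpPoly_neg_two {a : ℤ} (ha : (2 : ℤ) ∣ a) :
    ∀ m : ℕ, (2 : ℤ) ^ (m / 2) ∣ (sharpPoly a 2 m).eval (-2) := by
  -- joint induction on `(m+1, m+2)`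
  have key : ∀ m : ℕ, (2 : ℤ) ^ ((m + 1) / 2) ∣ (sharpPoly a 2 (m + 1)).eval (-2) ∧
      (2 : ℤ) ^ ((m + 2) / 2) ∣ (sharpPoly a 2 (m + 2)).eval (-2) := by
    intro m
    induction m with
    | zero =>
      refine ⟨by simp, ?_⟩
      rw [sharpPoly_two, eval_C]
      simpa using ha
    | succ m ih =>
      refine ⟨by simpa [show m + 1 + 1 = m + 2 by ring] using ih.2, ?_⟩
      rw [show m + 1 + 2 = m + 3 by ring, eval_neg_two_sharpPoly_add_three]
      refine dvd_sub ?_ ?_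
      · -- `2^{⌊(m+3)/2⌋} ∣ a ε_{m+2}`: `2 ∣ a` and `2^{⌊(m+2)/2⌋} ∣ ε_{m+2}`
        have h := mul_dvd_mul ha ih.2
        rw [← pow_succ'] at h
        exact (pow_dvd_pow 2 (by omega)).trans h
      · have h := mul_dvd_mul (dvd_refl (2 : ℤ)) ih.1
        rw [← pow_succ'] at h
        exact (pow_dvd_pow 2 (by omega)).trans h
  intro m
  cases m with
  | zero => simp
  | succ m => exact (key m).1

/-! ## §2 Division by `T + 2` and the line polynomials -/

/-- **Division by `T + 2` of a `2^s`-multiple**: if `(T + 2)·P = c·R` in `ℤ[T]` with `c ≠ 0`, then `P = c·R'` for some `R'`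
(`R(−2) = 0`, so `T + 2 ∣ R`). [folklore] -/
theorem exists_eq_C_mul_of_X_add_two_mul_eq {P R : ℤ[X]} {c : ℤ} (hc : c ≠ 0) (h : (X + 2) * P = C c * R) :
    ∃ R' : ℤ[X], P = C c * R' := by
  have hroot : R.IsRoot (-2) := by
    have h1 := congrArg (eval (-2)) h
    rw [eval_mul, eval_add, eval_X, eval_ofNat, eval_mul, eval_C] at h1
    norm_num at h1
    rcases h1 with h1 | h1
    · exact (hc h1).elim
    · exact h1
  have hdiv := (mul_divByMonic_eq_iff_isRoot (p := R) (a := (-2 : ℤ))).mpr hroot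
  rw [map_neg, sub_neg_eq_add, show (C 2 : ℤ[X]) = 2 from rfl] at hdiv
  refine ⟨R /ₘ (X + 2), mul_left_cancel₀ (show (X + 2 : ℤ[X]) ≠ 0 from ?_) ?_⟩
  · rw [show (X + 2 : ℤ[X]) = X + C 2 from rfl]
    exact X_add_C_ne_zero 2
  · rw [h]
    nth_rw 1 [← hdiv]
    ring

/-- ★ **THE LINE POLYNOMIALS.**  For even `a` and `n = 2k + 2` there are `α, β, q, A', B' ∈ ℤ[T]` with `(T + 2)·q = ω_n`, `q(−1) = −1`,
`deg q < 2^n`, `α u_n + β Φ_{2^n}(1+T) u_{n−1} = 2^{k+2} A'` and `α v_n + β Φ_{2^n}(1+T) v_{n−1} = q + 2^{k+2} B'`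
(`u = sharpPoly a 2`, `v = flatPoly a 2`).  Witnesses: `α = −(Tφ_n u_{n−1} + 4ε_{n−1})/(T+2)`, `β = (T u_n + 2ε_n)/(T+2)` with
`ε_m = u_m(−2)`; see the module docstring. [cite: Sprung2017, §4 Cor. 4.4] [cite: Pollack2003, Thm. 6.17] -/
theorem exists_linePolys {a : ℤ} (ha : (2 : ℤ) ∣ a) (k : ℕ) :
    ∃ α β q A' B' : ℤ[X],
      (X + 2) * q = cyclotomicOmega 2 (2 * k + 2) ∧ q.eval (-1) = -1 ∧ q.natDegree < 2 ^ (2 * k + 2) ∧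
      α * sharpPoly a 2 (2 * k + 2) + β * ((cyclotomic (2 ^ (2 * k + 2)) ℤ).comp (X + 1) * sharpPoly a 2 (2 * k + 1)) =
        C (2 ^ (k + 2)) * A' ∧
      α * flatPoly a 2 (2 * k + 2) + β * ((cyclotomic (2 ^ (2 * k + 2)) ℤ).comp (X + 1) * flatPoly a 2 (2 * k + 1)) =
        q + C (2 ^ (k + 2)) * B' := by
  -- the products `∏_{i ≤ 2k+2} φ_i` and `∏_{i ≤ 2k+1} φ_i`
  have hprod : ∏ i ∈ Finset.range (2 * k + 2), (cyclotomic (2 ^ (i + 1)) ℤ).comp (X + 1) =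
      (∏ i ∈ Finset.range (2 * k + 1), (cyclotomic (2 ^ (i + 1)) ℤ).comp (X + 1)) *
        (cyclotomic (2 ^ (2 * k + 2)) ℤ).comp (X + 1) :=
    Finset.prod_range_succ _ (2 * k + 1)
  have hprod' : ∏ i ∈ Finset.range (2 * k + 2), (cyclotomic (2 ^ (i + 1)) ℤ).comp (X + 1) =
      (X + 2) * ∏ i ∈ Finset.range (2 * k + 1), (cyclotomic (2 ^ (i + 2)) ℤ).comp (X + 1) := by
    rw [Finset.prod_range_succ', zero_add, cyclotomic_two_pow_one_comp, mul_comm]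
  -- notation
  set un := sharpPoly a 2 (2 * k + 2) with hun
  set un1 := sharpPoly a 2 (2 * k + 1) with hun1
  set vn := flatPoly a 2 (2 * k + 2) with hvn
  set vn1 := flatPoly a 2 (2 * k + 1) with hvn1
  set φ := (cyclotomic (2 ^ (2 * k + 2)) ℤ).comp (X + 1) with hφ
  set εn : ℤ := un.eval (-2) with hεn
  set εn1 : ℤ := un1.eval (-2) with hεn1
  have hφ2 : φ.eval (-2) = 2 := eval_neg_two_cyclotomic_comp_add_two (2 * k)
  -- `q = T · ∏_{2 ≤ i ≤ n} φ_i`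
  set q : ℤ[X] := X * ∏ i ∈ Finset.range (2 * k + 1), (cyclotomic (2 ^ (i + 2)) ℤ).comp (X + 1) with hq
  have hXq : (X + 2) * q = cyclotomicOmega 2 (2 * k + 2) := by
    rw [← X_mul_prod_cyclotomic_comp_eq_cyclotomicOmega 2 (2 * k + 2), hprod', hq]
    ring
  have hq1 : q.eval (-1) = -1 := by
    rw [hq, eval_mul, eval_X, eval_prod]
    simp only [show ∀ i : ℕ, i + 2 = (i + 1) + 1 from fun i ↦ by ring, eval_neg_one_cyclotomic_comp_succ,
      Finset.prod_const_one, mul_one]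
  have hq0 : q ≠ 0 := by
    intro h; rw [h, eval_zero] at hq1; norm_num at hq1
  have hqdeg : q.natDegree < 2 ^ (2 * k + 2) := by
    have hX2 : (X + 2 : ℤ[X]) = X + C 2 := rfl
    have h := congrArg natDegree hXq
    rw [natDegree_mul (by rw [hX2]; exact X_add_C_ne_zero 2) hq0, hX2, natDegree_X_add_C] at h
    have hω : (cyclotomicOmega 2 (2 * k + 2)).natDegree = 2 ^ (2 * k + 2) := by
      have hX1 : (X + 1 : ℤ[X]).natDegree = 1 := by rw [← C_1, natDegree_X_add_C]
      have hpow : ((X + 1 : ℤ[X]) ^ 2 ^ (2 * k + 2)).natDegree = 2 ^ (2 * k + 2) := by rw [natDegree_pow, hX1, mul_one]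
      rw [cyclotomicOmega, natDegree_sub_eq_left_of_natDegree_lt, hpow]
      rw [hpow, natDegree_one]; positivity
    omega
  -- `α`, `β` by exact division
  obtain ⟨α, hα⟩ : ∃ α : ℤ[X], (X + 2) * α = -(X * φ * un1 + C (4 * εn1)) := by
    have hd := X_sub_C_dvd_sub_C_eval (p := -(X * φ * un1)) (a := (-2 : ℤ))
    rw [map_neg, sub_neg_eq_add, show (C 2 : ℤ[X]) = 2 from rfl] at hd
    obtain ⟨α, hα⟩ := hd
    refine ⟨α, ?_⟩
    rw [← hα, eval_neg, eval_mul, eval_mul, eval_X, hφ2, ← hεn1, map_mul, show (C 4 : ℤ[X]) = 4 from rfl, map_neg,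
      map_mul, map_mul, map_neg, show (C 2 : ℤ[X]) = 2 from rfl]
    ring
  obtain ⟨β, hβ⟩ : ∃ β : ℤ[X], (X + 2) * β = X * un + C (2 * εn) := by
    have hd := X_sub_C_dvd_sub_C_eval (p := X * un) (a := (-2 : ℤ))
    rw [map_neg, sub_neg_eq_add, show (C 2 : ℤ[X]) = 2 from rfl] at hd
    obtain ⟨β, hβ⟩ := hd
    refine ⟨β, ?_⟩
    rw [← hβ, eval_mul, eval_X, ← hεn, map_mul, map_mul, map_neg, show (C 2 : ℤ[X]) = 2 from rfl]
    ring
  -- the `2`-divisibility of the constants (`n = 2k+2`, `n − 1 = 2k+1`)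
  obtain ⟨e₁, he₁⟩ : (2 : ℤ) ^ (k + 1) ∣ εn := by
    have h := pow_dvd_eval_sharpPoly_neg_two ha (2 * k + 2)
    rwa [show (2 * k + 2) / 2 = k + 1 by omega] at h
  obtain ⟨e₂, he₂⟩ : (2 : ℤ) ^ k ∣ εn1 := by
    have h := pow_dvd_eval_sharpPoly_neg_two ha (2 * k + 1)
    rwa [show (2 * k + 1) / 2 = k by omega] at h
  have h2εn : 2 * εn = 2 ^ (k + 2) * e₁ := by rw [he₁]; ring
  have h4εn1 : 4 * εn1 = 2 ^ (k + 2) * e₂ := by rw [he₂]; ring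
  -- the Casoratian and `ω_n = T ∏ φ_i`
  have hW : un * vn1 - vn * un1 = ∏ i ∈ Finset.range (2 * k + 1), (cyclotomic (2 ^ (i + 1)) ℤ).comp (X + 1) :=
    sharpPoly_succ_mul_flatPoly_sub (p := 2) a (2 * k + 1)
  have hωW : X * φ * (un * vn1 - vn * un1) = cyclotomicOmega 2 (2 * k + 2) := by
    rw [hW, ← X_mul_prod_cyclotomic_comp_eq_cyclotomicOmega 2 (2 * k + 2), hprod, hφ]
    ring
  -- `(T+2) A = 2^{k+2} (e₁ φ u_{n−1} − e₂ u_n)` and `(T+2) B = ω_n + 2^{k+2} (e₁ φ v_{n−1} − e₂ v_n)`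
  have hA : (X + 2) * (α * un + β * (φ * un1)) = C (2 ^ (k + 2)) * (C e₁ * φ * un1 - C e₂ * un) := by
    have e : (X + 2) * (α * un + β * (φ * un1)) = ((X + 2) * α) * un + ((X + 2) * β) * (φ * un1) := by ring
    rw [e, hα, hβ, h4εn1, h2εn, map_mul, map_mul, map_pow, show (C 2 : ℤ[X]) = 2 from rfl]
    ring
  have hB : (X + 2) * (α * vn + β * (φ * vn1) - q) = C (2 ^ (k + 2)) * (C e₁ * φ * vn1 - C e₂ * vn) := by
    have e : (X + 2) * (α * vn + β * (φ * vn1) - q) =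
        ((X + 2) * α) * vn + ((X + 2) * β) * (φ * vn1) - (X + 2) * q := by ring
    rw [e, hα, hβ, hXq, ← hωW, h4εn1, h2εn, map_mul, map_mul, map_pow, show (C 2 : ℤ[X]) = 2 from rfl]
    ring
  have hc : (2 : ℤ) ^ (k + 2) ≠ 0 := pow_ne_zero _ two_ne_zero
  obtain ⟨A', hA'⟩ := exists_eq_C_mul_of_X_add_two_mul_eq hc hA
  obtain ⟨B', hB'⟩ := exists_eq_C_mul_of_X_add_two_mul_eq hc hB
  exact ⟨α, β, q, A', B', hXq, hq1, hqdeg, hA', by rw [← hB']; ring⟩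

end OddBlindLocal

end Summit.BirchSwinnertonDyer.BirchSwinnertonDyer.Theorems

end
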